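import Literature.MathematicalPhysics.QuantumLattice.HubbardTTPrimeBoxWordCovering
import Literature.MathematicalPhysics.QuantumLattice.HubbardNNNHoppingTPrimeChordBounds
import HarnessLib

/-!
# The cap BETWEEN two capped certified columns of the `t–t'` Hubbard energy density:
# two tangents (or two secants) and the sign-aware "harmonic" bulge law

Family `hubbard` (topic `MathematicalPhysics/QuantumLattice`); written for stage S2
"certifier-families" of the Hubbard material-oracle programme (certified WORDS over parameter BOXES
`(U/t, t'/t, n)`), seat `hubbard-box-p3` (the `t'`-direction transport lemmas), companion of
`HubbardTTPrimeBoxTransport` (§4 there: the cap between two capped columns with the KINEMATIC constant,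
loss `(16/π²)·(s₂ - s₁)/2`), `HubbardTTPrimeBoxWordCovering` (§1/§7: ONE anchor column and its
sign-split slope brackets) and `HubbardTTPrimeDiagHopTransport` (§5: energy increments from endpoint
`K₂` words). Notation: `e(t,t',U,n) = energyDensityTT' t t' U n` (concave in `t'`,
`concaveOn_energyDensityTT'_tPrime`); `K₂(ω) = ω.meanEnergy (hubbardTTPrimeFermionInteraction 0 1 0) 1`
is the unit diagonal-hopping mean energy of an infinite-volume state (`= -HOP2` in the fast cell's
dictionary); a "ceiling word `A` at `s₁`" is the certified statement `K₂(ω) ≤ A` for every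
torus-limit ground state `ω` at `(t, s₁, U)`, density `n` (the hypothesis class of all `t–t'`
correlator certificates), a "floor word `B` at `s₂`" is `B ≤ K₂(ω)` there.

THE POINT. Two certified columns `s₁ < s₂` of a `t'`-cell, each CAPPED (`e(t,sᵢ,U,n) ≤ Rᵢ`), do not
cap the concave `t' ↦ e` between them by themselves; the kinematic law pays half the gap at slope
`16/π²`, the one-anchor tangent plane pays the full gap at the anchor's bracket end. With a ceiling word
`A` at the LEFT column and a floor word `B` at the RIGHT column the two Hellmann–Feynman tangents
`e ≤ R₁ + A (t' - s₁)` and `e ≤ R₂ + (-B)(s₂ - t')` hold simultaneously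
(`energyDensityTT'_le_min_tangents_of_columnWords`), and the minimum of two such affine majorants is
uniformly bounded on the cell by

* the weighted form `((-B) R₁ + A R₂ + A (-B) (s₂ - s₁)) / (A - B)` when `A ≥ 0 ≥ B`, `A - B > 0`
  (`energyDensityTT'_tPrime_interval_le_wavg_of_columnWords`), and in general by
* `max R₁ R₂ + (s₂ - s₁)·A⁺β⁺/(A⁺ + β⁺)` with `β = -B`, `x⁺ = max x 0`
  (`energyDensityTT'_tPrime_interval_le_of_columnWords`; Lean's `x / 0 = 0` makes the bulge `0` when
  `A⁺ = β⁺ = 0`).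

The bulge `w·A⁺β⁺/(A⁺+β⁺)` is at most `w·min(A⁺,β⁺)` and at most `(w/2)·max(A⁺,β⁺)`
(`mul_div_add_le_min`, `mul_div_add_le_half_max`): never worse than the half-gap law, a factor
`(A⁺+β⁺)/(2 min(A⁺,β⁺))` better for asymmetric windows, and ZERO as soon as one slope SIGN is certified
(`A ≤ 0`: `e` is capped by `R₁` right of `s₁`; `B ≥ 0`: by `R₂` left of `s₂` —
`energyDensityTT'_le_leftCap_of_diagHop_nonpos`, `energyDensityTT'_le_rightCap_of_diagHop_nonneg`).
§3 is the WORD-FREE variant: floors `L₀`, `L₃` at outer columns `s₀ < s₁`, `s₃ > s₂` supply the two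
slopes by secant extrapolation (`α = (R₁ - L₀)/(s₁ - s₀)`, `β = (R₂ - L₃)/(s₃ - s₂)`, concavity), and the
two mixed variants (a word on one side, a secant on the other). §4 is the consumer shape: two anchor
columns each with the full `(docc, K₂)` slope-bracket package of
`energyDensityTT'_le_of_forall_isTorusLimitOf_slopes`, a target rectangle `[s₁, s₂] × [V₁, V₂]`.
§1 holds the three real lemmas (any function; the box-word kernels may use them directly).

HONEST FRAMING: bookkeeping of concavity and of the Hellmann–Feynman tangent inequality for the
systematic → certified interface; no number is produced here, every slope / cap / floor is a
hypothesis to be discharged by a certified row, and nothing here bears on superconductivity by itself.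
Everything is PROVED; no definition, no named fact, no numerical input.

## Mathlib / tree search

REUSED: `energyDensityTT'_sub_le_mul_of_forall_diagHop_le`, `mul_le_energyDensityTT'_sub_of_forall_le_diagHop`
(`HubbardTTPrimeDiagHopTransport` §5); `energyDensityTT'_le_of_forall_isTorusLimitOf_slopes`
(`HubbardTTPrimeMeanEnergySupergradient` §4); `max_sub_mul_le_cornerMax`
(`HubbardTTPrimeBoxWordCovering` §1); `energyDensityTT'_tPrime_le_extrapolate_right/left`
(`HubbardNNNHoppingTPrimeChordBounds`); `energyDensityTT'_ge_min_of_mem_Icc_tPrime` (closed-box floor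
rule); `energyDensityTT'_mono_U`. `lean search 'two_tangent|min_tangents|harmonic.*bulge|of_columnWords|
le_wavg'` in `Literature/`: no prior statement; the tree's two-column cap is kinematic only
(`energyDensityTT'_tPrime_interval_le_kinematic`).

## References

* R. B. Israel, *Convexity in the Theory of Lattice Gases*, Princeton (1979), Thm. I.3.4 (tangent
  functionals of the concave energy density are global affine majorants). [cite: Israel1979, Thm. I.3.4]
* T. Koma, H. Tasaki, J. Stat. Phys. 76 (1994) 745, §1 (the conjugate observable is a supergradient of
  the ground-state energy in a linear coupling). [cite: KomaTasaki1994, §1]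
* A. Neumaier, *Complete search in continuous global optimization and constraint satisfaction*, Acta
  Numerica 13 (2004) 271, §11 (slope / centred forms: affine enclosures from interval derivative
  bounds at the endpoints of a box). [cite: Neumaier2004CompleteSearch, §11]
* D. Ruelle, *Statistical Mechanics: Rigorous Results* (1969), §3.3 (concavity of the ground-state
  energy density in the couplings; chords and secants). [cite: Ruelle1969, §3.3]
-/

noncomputable section

namespace Literature.MathematicalPhysics.QuantumLattice

open Matrix Finset HubbardWave0 Literature.Probability.LatticeModels ThermodynamicLimit
open _root_.Filter
open scoped _root_.Topology ComplexOrder BigOperators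

namespace ThermodynamicLimit

open InfVolFermionState

/-! ### §1 Three real lemmas: the minimum of two affine majorants over a segment -/

/-- **Weighted form.** If `y ≤ P₁ + α (x - s₁)` and `y ≤ P₂ + β (s₂ - x)` with `α, β ≥ 0`,
`α + β > 0`, then `y ≤ (β P₁ + α P₂ + α β (s₂ - s₁)) / (α + β)` (add `β` times the first to `α` times
the second; no hypothesis on the position of `x`). [cite: Neumaier2004CompleteSearch, §11] -/
theorem le_wavg_of_le_two_affine {y x s₁ s₂ P₁ P₂ α β : ℝ} (hα : 0 ≤ α) (hβ : 0 ≤ β)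
    (hαβ : 0 < α + β) (h₁ : y ≤ P₁ + α * (x - s₁)) (h₂ : y ≤ P₂ + β * (s₂ - x)) :
    y ≤ (β * P₁ + α * P₂ + α * β * (s₂ - s₁)) / (α + β) := by
  rw [le_div_iff₀ hαβ]
  have e₁ := mul_le_mul_of_nonneg_left h₁ hβ
  have e₂ := mul_le_mul_of_nonneg_left h₂ hα
  nlinarith [e₁, e₂]

/-- **Harmonic form (sign-aware).** If `y ≤ P₁ + α (x - s₁)` and `y ≤ P₂ + β (s₂ - x)` for some
`x ∈ [s₁, s₂]` (any real `α`, `β`), then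
`y ≤ max P₁ P₂ + (s₂ - s₁) · (α⁺ β⁺) / (α⁺ + β⁺)` with `α⁺ = max α 0`, `β⁺ = max β 0`; the last term
is `0` when `α ≤ 0` or `β ≤ 0` (then one majorant alone is below its constant; Lean's `x / 0 = 0`
covers `α⁺ = β⁺ = 0`). [cite: Neumaier2004CompleteSearch, §11] -/
theorem le_max_add_bulge_of_le_two_affine {y x s₁ s₂ P₁ P₂ α β : ℝ} (hx₁ : s₁ ≤ x) (hx₂ : x ≤ s₂)
    (h₁ : y ≤ P₁ + α * (x - s₁)) (h₂ : y ≤ P₂ + β * (s₂ - x)) :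
    y ≤ max P₁ P₂ + (s₂ - s₁) * (max α 0 * max β 0) / (max α 0 + max β 0) := by
  set a := max α 0 with ha_def
  set b := max β 0 with hb_def
  have ha : 0 ≤ a := le_max_right _ _
  have hb : 0 ≤ b := le_max_right _ _
  have h₁' : y ≤ P₁ + a * (x - s₁) := by
    have := mul_le_mul_of_nonneg_right (le_max_left α 0) (sub_nonneg.2 hx₁)
    linarith
  have h₂' : y ≤ P₂ + b * (s₂ - x) := by
    have := mul_le_mul_of_nonneg_right (le_max_left β 0) (sub_nonneg.2 hx₂)
    linarith
  have hM₁ := le_max_left P₁ P₂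
  have hM₂ := le_max_right P₁ P₂
  rcases (add_nonneg ha hb).eq_or_lt with h0 | hpos
  · -- `a = b = 0`: the first majorant is below `P₁`
    have ha0 : a = 0 := by linarith
    rw [ha0, zero_mul, zero_add, mul_zero, zero_div, add_zero]
    rw [ha0, zero_mul, add_zero] at h₁'
    exact h₁'.trans hM₁
  · have h := le_wavg_of_le_two_affine ha hb hpos h₁' h₂'
    have key : (b * P₁ + a * P₂ + a * b * (s₂ - s₁)) / (a + b) ≤
        max P₁ P₂ + (s₂ - s₁) * (a * b) / (a + b) := by
      rw [div_le_iff₀ hpos, add_mul, div_mul_cancel₀ _ hpos.ne']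
      have e₁ := mul_le_mul_of_nonneg_left hM₁ hb
      have e₂ := mul_le_mul_of_nonneg_left hM₂ ha
      nlinarith [e₁, e₂]
    exact h.trans key

/-- The harmonic bulge is below the smaller slope: `w·ab/(a+b) ≤ w·min a b` for `a, b, w ≥ 0`.
[cite: Neumaier2004CompleteSearch, §11] -/
theorem mul_div_add_le_min {w a b : ℝ} (hw : 0 ≤ w) (ha : 0 ≤ a) (hb : 0 ≤ b) :
    w * (a * b) / (a + b) ≤ w * min a b := by
  rcases (add_nonneg ha hb).eq_or_lt with h0 | hpos
  · rw [← h0, div_zero]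
    exact mul_nonneg hw (le_min ha hb)
  · rw [div_le_iff₀ hpos]
    rcases min_cases a b with ⟨hm, hab⟩ | ⟨hm, hab⟩
    · rw [hm]
      have : a * a ≤ a * b := mul_le_mul_of_nonneg_left hab ha
      nlinarith [mul_nonneg hw ha]
    · rw [hm]
      have : b * b ≤ a * b := by nlinarith
      nlinarith [mul_nonneg hw hb]

/-- The harmonic bulge is below HALF the larger slope: `w·ab/(a+b) ≤ (w/2)·max a b` for
`a, b, w ≥ 0` — the sign-aware law is never worse than the half-gap law with the larger constant.
[cite: Neumaier2004CompleteSearch, §11] -/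
theorem mul_div_add_le_half_max {w a b : ℝ} (hw : 0 ≤ w) (ha : 0 ≤ a) (hb : 0 ≤ b) :
    w * (a * b) / (a + b) ≤ w / 2 * max a b := by
  rcases (add_nonneg ha hb).eq_or_lt with h0 | hpos
  · rw [← h0, div_zero]
    exact mul_nonneg (by linarith) (ha.trans (le_max_left a b))
  · rw [div_le_iff₀ hpos]
    have h1 := le_max_left a b
    have h2 := le_max_right a b
    have e₁ := mul_le_mul_of_nonneg_left h2 ha   -- a b ≤ a M
    have e₂ := mul_le_mul_of_nonneg_left h1 hb   -- b a ≤ b M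
    have hM : 0 ≤ max a b := ha.trans h1
    nlinarith [mul_nonneg hw ha, mul_nonneg hw hb, mul_nonneg hw hM, e₁, e₂]

/-! ### §2 Two capped columns with their own `K₂` words: two tangents -/

/-- **Two tangents.** Columns `s₁ ≤ s ≤ s₂` at fixed `(t, U, n)` (`U ≥ 0`, `0 ≤ n < 2`), caps
`e(t,s₁,U,n) ≤ R₁`, `e(t,s₂,U,n) ≤ R₂`, a ceiling word `A` at `s₁` and a floor word `B` at `s₂`:
`e(t,s,U,n) ≤ min (R₁ + A (s - s₁)) (R₂ + (-B)(s₂ - s))` — the Hellmann–Feynman tangent at a ground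
state of each column, read towards the interior of the cell. [cite: KomaTasaki1994, §1]
[cite: Israel1979, Thm. I.3.4] -/
theorem energyDensityTT'_le_min_tangents_of_columnWords (t : ℝ) {U : ℝ} (hU : 0 ≤ U) {n : ℝ}
    (hn0 : 0 ≤ n) (hn2 : n < 2) {s₁ s₂ R₁ R₂ A B : ℝ}
    (hR₁ : energyDensityTT' t s₁ U n ≤ R₁) (hR₂ : energyDensityTT' t s₂ U n ≤ R₂)
    (hA : ∀ (ω₁ : InfVolFermionState 2) (Ls₁ : ℕ → ℕ) (ψ₁ : ∀ L, Fock (Orb (FermionTorus 2 L))),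
      Tendsto Ls₁ atTop atTop →
      (∀ j, IsGroundStateInSector (hubbardTorusTT' (Ls₁ j) t s₁ U) (rectN n (Ls₁ j)) 0 (ψ₁ (Ls₁ j))) →
      (∀ j, star (ψ₁ (Ls₁ j)) ⬝ᵥ ψ₁ (Ls₁ j) = 1) → ω₁.IsTorusLimitOf ψ₁ Ls₁ →
      ω₁.meanEnergy (hubbardTTPrimeFermionInteraction 0 1 0) 1 ≤ A)
    (hB : ∀ (ω₂ : InfVolFermionState 2) (Ls₂ : ℕ → ℕ) (ψ₂ : ∀ L, Fock (Orb (FermionTorus 2 L))),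
      Tendsto Ls₂ atTop atTop →
      (∀ j, IsGroundStateInSector (hubbardTorusTT' (Ls₂ j) t s₂ U) (rectN n (Ls₂ j)) 0 (ψ₂ (Ls₂ j))) →
      (∀ j, star (ψ₂ (Ls₂ j)) ⬝ᵥ ψ₂ (Ls₂ j) = 1) → ω₂.IsTorusLimitOf ψ₂ Ls₂ →
      B ≤ ω₂.meanEnergy (hubbardTTPrimeFermionInteraction 0 1 0) 1)
    {s : ℝ} (h₁ : s₁ ≤ s) (h₂ : s ≤ s₂) :
    energyDensityTT' t s U n ≤ min (R₁ + A * (s - s₁)) (R₂ + (-B) * (s₂ - s)) := by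
  have hup := energyDensityTT'_sub_le_mul_of_forall_diagHop_le t (le_refl s₁) h₁ hU hn0 hn2 hA
  have hdn := mul_le_energyDensityTT'_sub_of_forall_le_diagHop t h₂ (le_refl s₂) hU hn0 hn2 hB
  exact le_min (by linarith) (by linarith)

/-- **Weighted two-column cap.** Same data with `0 ≤ A`, `B ≤ 0`, `0 < A - B`: on `[s₁, s₂]`,
`e(t,s,U,n) ≤ (A R₂ - B R₁ - A B (s₂ - s₁)) / (A - B)` — the value at the crossing of the two tangents,
one number for the whole cell. [cite: KomaTasaki1994, §1] [cite: Neumaier2004CompleteSearch, §11] -/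
theorem energyDensityTT'_tPrime_interval_le_wavg_of_columnWords (t : ℝ) {U : ℝ} (hU : 0 ≤ U) {n : ℝ}
    (hn0 : 0 ≤ n) (hn2 : n < 2) {s₁ s₂ R₁ R₂ A B : ℝ} (hA0 : 0 ≤ A) (hB0 : B ≤ 0) (hAB : 0 < A - B)
    (hR₁ : energyDensityTT' t s₁ U n ≤ R₁) (hR₂ : energyDensityTT' t s₂ U n ≤ R₂)
    (hA : ∀ (ω₁ : InfVolFermionState 2) (Ls₁ : ℕ → ℕ) (ψ₁ : ∀ L, Fock (Orb (FermionTorus 2 L))),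
      Tendsto Ls₁ atTop atTop →
      (∀ j, IsGroundStateInSector (hubbardTorusTT' (Ls₁ j) t s₁ U) (rectN n (Ls₁ j)) 0 (ψ₁ (Ls₁ j))) →
      (∀ j, star (ψ₁ (Ls₁ j)) ⬝ᵥ ψ₁ (Ls₁ j) = 1) → ω₁.IsTorusLimitOf ψ₁ Ls₁ →
      ω₁.meanEnergy (hubbardTTPrimeFermionInteraction 0 1 0) 1 ≤ A)
    (hB : ∀ (ω₂ : InfVolFermionState 2) (Ls₂ : ℕ → ℕ) (ψ₂ : ∀ L, Fock (Orb (FermionTorus 2 L))),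
      Tendsto Ls₂ atTop atTop →
      (∀ j, IsGroundStateInSector (hubbardTorusTT' (Ls₂ j) t s₂ U) (rectN n (Ls₂ j)) 0 (ψ₂ (Ls₂ j))) →
      (∀ j, star (ψ₂ (Ls₂ j)) ⬝ᵥ ψ₂ (Ls₂ j) = 1) → ω₂.IsTorusLimitOf ψ₂ Ls₂ →
      B ≤ ω₂.meanEnergy (hubbardTTPrimeFermionInteraction 0 1 0) 1)
    {s : ℝ} (h₁ : s₁ ≤ s) (h₂ : s ≤ s₂) :
    energyDensityTT' t s U n ≤ (A * R₂ - B * R₁ - A * B * (s₂ - s₁)) / (A - B) := by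
  have h := energyDensityTT'_le_min_tangents_of_columnWords t hU hn0 hn2 hR₁ hR₂ hA hB h₁ h₂
  have hl := h.trans (min_le_left _ _)
  have hr := h.trans (min_le_right _ _)
  have hw := le_wavg_of_le_two_affine hA0 (neg_nonneg.2 hB0) (by linarith) hl hr
  have e : (-B * R₁ + A * R₂ + A * -B * (s₂ - s₁)) / (A + -B) =
      (A * R₂ - B * R₁ - A * B * (s₂ - s₁)) / (A - B) := by
    rw [← sub_eq_add_neg]
    congr 1
    ring
  rwa [e] at hw

/-- **The sign-aware two-column cap (harmonic bulge law).** Columns `s₁ ≤ s ≤ s₂`, caps `R₁`, `R₂`,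
a ceiling word `A` at `s₁`, a floor word `B` at `s₂` (any signs): on `[s₁, s₂]`,
`e(t,s,U,n) ≤ max R₁ R₂ + (s₂ - s₁)·(A⁺ (-B)⁺)/(A⁺ + (-B)⁺)` with `x⁺ = max x 0`. The bulge vanishes
when `A ≤ 0` or `B ≥ 0` (a certified slope sign), is at most `(s₂ - s₁)·min(A⁺, (-B)⁺)` and at most
the half-gap law `((s₂ - s₁)/2)·max(A⁺, (-B)⁺)` (`mul_div_add_le_min`, `mul_div_add_le_half_max`).
[cite: KomaTasaki1994, §1] [cite: Neumaier2004CompleteSearch, §11] -/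
theorem energyDensityTT'_tPrime_interval_le_of_columnWords (t : ℝ) {U : ℝ} (hU : 0 ≤ U) {n : ℝ}
    (hn0 : 0 ≤ n) (hn2 : n < 2) {s₁ s₂ R₁ R₂ A B : ℝ}
    (hR₁ : energyDensityTT' t s₁ U n ≤ R₁) (hR₂ : energyDensityTT' t s₂ U n ≤ R₂)
    (hA : ∀ (ω₁ : InfVolFermionState 2) (Ls₁ : ℕ → ℕ) (ψ₁ : ∀ L, Fock (Orb (FermionTorus 2 L))),
      Tendsto Ls₁ atTop atTop →
      (∀ j, IsGroundStateInSector (hubbardTorusTT' (Ls₁ j) t s₁ U) (rectN n (Ls₁ j)) 0 (ψ₁ (Ls₁ j))) →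
      (∀ j, star (ψ₁ (Ls₁ j)) ⬝ᵥ ψ₁ (Ls₁ j) = 1) → ω₁.IsTorusLimitOf ψ₁ Ls₁ →
      ω₁.meanEnergy (hubbardTTPrimeFermionInteraction 0 1 0) 1 ≤ A)
    (hB : ∀ (ω₂ : InfVolFermionState 2) (Ls₂ : ℕ → ℕ) (ψ₂ : ∀ L, Fock (Orb (FermionTorus 2 L))),
      Tendsto Ls₂ atTop atTop →
      (∀ j, IsGroundStateInSector (hubbardTorusTT' (Ls₂ j) t s₂ U) (rectN n (Ls₂ j)) 0 (ψ₂ (Ls₂ j))) →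
      (∀ j, star (ψ₂ (Ls₂ j)) ⬝ᵥ ψ₂ (Ls₂ j) = 1) → ω₂.IsTorusLimitOf ψ₂ Ls₂ →
      B ≤ ω₂.meanEnergy (hubbardTTPrimeFermionInteraction 0 1 0) 1)
    {s : ℝ} (h₁ : s₁ ≤ s) (h₂ : s ≤ s₂) :
    energyDensityTT' t s U n ≤
      max R₁ R₂ + (s₂ - s₁) * (max A 0 * max (-B) 0) / (max A 0 + max (-B) 0) := by
  have h := energyDensityTT'_le_min_tangents_of_columnWords t hU hn0 hn2 hR₁ hR₂ hA hB h₁ h₂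
  exact le_max_add_bulge_of_le_two_affine h₁ h₂ (h.trans (min_le_left _ _))
    (h.trans (min_le_right _ _))

/-- **A certified sign caps a half-line: `K₂ ≤ 0` at `s₁`.** If every torus-limit ground state at
`(t, s₁, U)` has `K₂ ≤ 0` and `e(t,s₁,U,n) ≤ R₁`, then `e(t,s,U,n) ≤ R₁` for every `s ≥ s₁` (the
concave `t' ↦ e` is non-increasing right of `s₁`; cf. `antitoneOn_energyDensityTT'_tPrime_of_forall_diagHop_nonpos`).
[cite: KomaTasaki1994, §1] [cite: Griffiths1966, §II] -/
theorem energyDensityTT'_le_leftCap_of_diagHop_nonpos (t : ℝ) {U : ℝ} (hU : 0 ≤ U) {n : ℝ}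
    (hn0 : 0 ≤ n) (hn2 : n < 2) {s₁ R₁ : ℝ} (hR₁ : energyDensityTT' t s₁ U n ≤ R₁)
    (hA : ∀ (ω₁ : InfVolFermionState 2) (Ls₁ : ℕ → ℕ) (ψ₁ : ∀ L, Fock (Orb (FermionTorus 2 L))),
      Tendsto Ls₁ atTop atTop →
      (∀ j, IsGroundStateInSector (hubbardTorusTT' (Ls₁ j) t s₁ U) (rectN n (Ls₁ j)) 0 (ψ₁ (Ls₁ j))) →
      (∀ j, star (ψ₁ (Ls₁ j)) ⬝ᵥ ψ₁ (Ls₁ j) = 1) → ω₁.IsTorusLimitOf ψ₁ Ls₁ →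
      ω₁.meanEnergy (hubbardTTPrimeFermionInteraction 0 1 0) 1 ≤ 0)
    {s : ℝ} (h₁ : s₁ ≤ s) : energyDensityTT' t s U n ≤ R₁ := by
  have hup := energyDensityTT'_sub_le_mul_of_forall_diagHop_le t (le_refl s₁) h₁ hU hn0 hn2 hA
  rw [zero_mul] at hup
  linarith

/-- **A certified sign caps a half-line: `0 ≤ K₂` at `s₂`.** If every torus-limit ground state at
`(t, s₂, U)` has `0 ≤ K₂` and `e(t,s₂,U,n) ≤ R₂`, then `e(t,s,U,n) ≤ R₂` for every `s ≤ s₂`.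
[cite: KomaTasaki1994, §1] [cite: Griffiths1966, §II] -/
theorem energyDensityTT'_le_rightCap_of_diagHop_nonneg (t : ℝ) {U : ℝ} (hU : 0 ≤ U) {n : ℝ}
    (hn0 : 0 ≤ n) (hn2 : n < 2) {s₂ R₂ : ℝ} (hR₂ : energyDensityTT' t s₂ U n ≤ R₂)
    (hB : ∀ (ω₂ : InfVolFermionState 2) (Ls₂ : ℕ → ℕ) (ψ₂ : ∀ L, Fock (Orb (FermionTorus 2 L))),
      Tendsto Ls₂ atTop atTop →
      (∀ j, IsGroundStateInSector (hubbardTorusTT' (Ls₂ j) t s₂ U) (rectN n (Ls₂ j)) 0 (ψ₂ (Ls₂ j))) →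
      (∀ j, star (ψ₂ (Ls₂ j)) ⬝ᵥ ψ₂ (Ls₂ j) = 1) → ω₂.IsTorusLimitOf ψ₂ Ls₂ →
      0 ≤ ω₂.meanEnergy (hubbardTTPrimeFermionInteraction 0 1 0) 1)
    {s : ℝ} (h₂ : s ≤ s₂) : energyDensityTT' t s U n ≤ R₂ := by
  have hdn := mul_le_energyDensityTT'_sub_of_forall_le_diagHop t h₂ (le_refl s₂) hU hn0 hn2 hB
  rw [zero_mul] at hdn
  linarith

/-- **The window between two certified columns, sign-aware cap.** Columns `s₁ ≤ s₂` with windows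
`[L₁, R₁]`, `[L₂, R₂]`, a ceiling word `A` at `s₁` and a floor word `B` at `s₂`: on `[s₁, s₂]`,
`min L₁ L₂ ≤ e(t,s,U,n) ≤ max R₁ R₂ + (s₂ - s₁)·(A⁺ (-B)⁺)/(A⁺ + (-B)⁺)` — the floor side is free
(concavity), the cap side pays the harmonic bulge instead of `(16/π²)(s₂ - s₁)/2`
(`energyDensityTT'_tPrime_mem_Icc_between_columns_kinematic`). [cite: Israel1979, Thm. I.3.4]
[cite: KomaTasaki1994, §1] -/
theorem energyDensityTT'_tPrime_mem_Icc_between_columns_of_columnWords (t : ℝ) {U : ℝ} (hU : 0 ≤ U)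
    {n : ℝ} (hn0 : 0 ≤ n) (hn2 : n < 2) {s₁ s₂ L₁ R₁ L₂ R₂ A B : ℝ}
    (hL₁ : L₁ ≤ energyDensityTT' t s₁ U n) (hR₁ : energyDensityTT' t s₁ U n ≤ R₁)
    (hL₂ : L₂ ≤ energyDensityTT' t s₂ U n) (hR₂ : energyDensityTT' t s₂ U n ≤ R₂)
    (hA : ∀ (ω₁ : InfVolFermionState 2) (Ls₁ : ℕ → ℕ) (ψ₁ : ∀ L, Fock (Orb (FermionTorus 2 L))),
      Tendsto Ls₁ atTop atTop →
      (∀ j, IsGroundStateInSector (hubbardTorusTT' (Ls₁ j) t s₁ U) (rectN n (Ls₁ j)) 0 (ψ₁ (Ls₁ j))) →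
      (∀ j, star (ψ₁ (Ls₁ j)) ⬝ᵥ ψ₁ (Ls₁ j) = 1) → ω₁.IsTorusLimitOf ψ₁ Ls₁ →
      ω₁.meanEnergy (hubbardTTPrimeFermionInteraction 0 1 0) 1 ≤ A)
    (hB : ∀ (ω₂ : InfVolFermionState 2) (Ls₂ : ℕ → ℕ) (ψ₂ : ∀ L, Fock (Orb (FermionTorus 2 L))),
      Tendsto Ls₂ atTop atTop →
      (∀ j, IsGroundStateInSector (hubbardTorusTT' (Ls₂ j) t s₂ U) (rectN n (Ls₂ j)) 0 (ψ₂ (Ls₂ j))) →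
      (∀ j, star (ψ₂ (Ls₂ j)) ⬝ᵥ ψ₂ (Ls₂ j) = 1) → ω₂.IsTorusLimitOf ψ₂ Ls₂ →
      B ≤ ω₂.meanEnergy (hubbardTTPrimeFermionInteraction 0 1 0) 1)
    {s : ℝ} (h₁ : s₁ ≤ s) (h₂ : s ≤ s₂) :
    energyDensityTT' t s U n ∈
      Set.Icc (min L₁ L₂) (max R₁ R₂ + (s₂ - s₁) * (max A 0 * max (-B) 0) / (max A 0 + max (-B) 0)) :=
  ⟨energyDensityTT'_ge_min_of_mem_Icc_tPrime t hU hn0 hn2 ⟨h₁, h₂⟩ hL₁ hL₂,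
    energyDensityTT'_tPrime_interval_le_of_columnWords t hU hn0 hn2 hR₁ hR₂ hA hB h₁ h₂⟩

/-! ### §3 Word-free: the slopes from secants through OUTER floors (four columns) -/

/-- **Two secants.** Columns `s₀ < s₁ ≤ s ≤ s₂ < s₃` at fixed `(t, U, n)`: floors `L₀` at `s₀`, `L₃` at
`s₃`, caps `R₁` at `s₁`, `R₂` at `s₂`. Then
`e(t,s,U,n) ≤ min (R₁ + (R₁ - L₀)/(s₁ - s₀)·(s - s₁)) (R₂ + (R₂ - L₃)/(s₃ - s₂)·(s₂ - s))` — the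
chords through `(s₀, s₁)` and through `(s₂, s₃)`, extended into the cell, lie above the concave `e`
(`energyDensityTT'_tPrime_le_extrapolate_right/left`); no `K₂` word is used. [cite: Ruelle1969, §3.3] -/
theorem energyDensityTT'_le_min_secants_of_outerFloors (t : ℝ) {U : ℝ} (hU : 0 ≤ U) {n : ℝ}
    (hn0 : 0 ≤ n) (hn2 : n < 2) {s₀ s₁ s₂ s₃ L₀ R₁ R₂ L₃ : ℝ} (h₀₁ : s₀ < s₁) (h₂₃ : s₂ < s₃)
    (hL₀ : L₀ ≤ energyDensityTT' t s₀ U n) (hR₁ : energyDensityTT' t s₁ U n ≤ R₁)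
    (hR₂ : energyDensityTT' t s₂ U n ≤ R₂) (hL₃ : L₃ ≤ energyDensityTT' t s₃ U n)
    {s : ℝ} (h₁ : s₁ ≤ s) (h₂ : s ≤ s₂) :
    energyDensityTT' t s U n ≤
      min (R₁ + (R₁ - L₀) / (s₁ - s₀) * (s - s₁)) (R₂ + (R₂ - L₃) / (s₃ - s₂) * (s₂ - s)) := by
  refine le_min ?_ ?_
  · rcases h₁.eq_or_lt with h | h
    · rw [← h, sub_self, mul_zero, add_zero]; exact hR₁
    · have h' := energyDensityTT'_tPrime_le_extrapolate_right t hU hn0 hn2 h₀₁ h hL₀ hR₁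
      have e : R₁ + (R₁ - L₀) * (s - s₁) / (s₁ - s₀) = R₁ + (R₁ - L₀) / (s₁ - s₀) * (s - s₁) := by
        ring
      rwa [e] at h'
  · rcases h₂.eq_or_lt with h | h
    · rw [h, sub_self, mul_zero, add_zero]; exact hR₂
    · have h' := energyDensityTT'_tPrime_le_extrapolate_left t hU hn0 hn2 h h₂₃ hR₂ hL₃
      have e : R₂ + (R₂ - L₃) * (s₂ - s) / (s₃ - s₂) = R₂ + (R₂ - L₃) / (s₃ - s₂) * (s₂ - s) := by
        ring
      rwa [e] at h'

/-- **The word-free two-column cap.** Same four columns: on `[s₁, s₂]`,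
`e(t,s,U,n) ≤ max R₁ R₂ + (s₂ - s₁)·(α⁺ β⁺)/(α⁺ + β⁺)` with the secant slopes
`α = (R₁ - L₀)/(s₁ - s₀)`, `β = (R₂ - L₃)/(s₃ - s₂)` (a floor above the neighbouring cap, `α ≤ 0` or
`β ≤ 0`, certifies monotonicity and kills the bulge). [cite: Ruelle1969, §3.3]
[cite: Neumaier2004CompleteSearch, §11] -/
theorem energyDensityTT'_tPrime_interval_le_of_outerFloors (t : ℝ) {U : ℝ} (hU : 0 ≤ U) {n : ℝ}
    (hn0 : 0 ≤ n) (hn2 : n < 2) {s₀ s₁ s₂ s₃ L₀ R₁ R₂ L₃ : ℝ} (h₀₁ : s₀ < s₁) (h₂₃ : s₂ < s₃)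
    (hL₀ : L₀ ≤ energyDensityTT' t s₀ U n) (hR₁ : energyDensityTT' t s₁ U n ≤ R₁)
    (hR₂ : energyDensityTT' t s₂ U n ≤ R₂) (hL₃ : L₃ ≤ energyDensityTT' t s₃ U n)
    {s : ℝ} (h₁ : s₁ ≤ s) (h₂ : s ≤ s₂) :
    energyDensityTT' t s U n ≤
      max R₁ R₂ + (s₂ - s₁) * (max ((R₁ - L₀) / (s₁ - s₀)) 0 * max ((R₂ - L₃) / (s₃ - s₂)) 0) /
        (max ((R₁ - L₀) / (s₁ - s₀)) 0 + max ((R₂ - L₃) / (s₃ - s₂)) 0) := by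
  have h := energyDensityTT'_le_min_secants_of_outerFloors t hU hn0 hn2 h₀₁ h₂₃ hL₀ hR₁ hR₂ hL₃ h₁ h₂
  exact le_max_add_bulge_of_le_two_affine h₁ h₂ (h.trans (min_le_left _ _))
    (h.trans (min_le_right _ _))

/-- **Mixed: ceiling word at the left column, secant at the right.** Columns `s₁ ≤ s ≤ s₂ < s₃`,
caps `R₁`, `R₂`, a ceiling word `A` at `s₁`, a floor `L₃` at `s₃`: on `[s₁, s₂]`,
`e(t,s,U,n) ≤ max R₁ R₂ + (s₂ - s₁)·(A⁺ β⁺)/(A⁺ + β⁺)`, `β = (R₂ - L₃)/(s₃ - s₂)`.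
[cite: KomaTasaki1994, §1] [cite: Ruelle1969, §3.3] -/
theorem energyDensityTT'_tPrime_interval_le_of_leftWord_rightSecant (t : ℝ) {U : ℝ} (hU : 0 ≤ U)
    {n : ℝ} (hn0 : 0 ≤ n) (hn2 : n < 2) {s₁ s₂ s₃ R₁ R₂ L₃ A : ℝ} (h₂₃ : s₂ < s₃)
    (hR₁ : energyDensityTT' t s₁ U n ≤ R₁) (hR₂ : energyDensityTT' t s₂ U n ≤ R₂)
    (hL₃ : L₃ ≤ energyDensityTT' t s₃ U n)
    (hA : ∀ (ω₁ : InfVolFermionState 2) (Ls₁ : ℕ → ℕ) (ψ₁ : ∀ L, Fock (Orb (FermionTorus 2 L))),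
      Tendsto Ls₁ atTop atTop →
      (∀ j, IsGroundStateInSector (hubbardTorusTT' (Ls₁ j) t s₁ U) (rectN n (Ls₁ j)) 0 (ψ₁ (Ls₁ j))) →
      (∀ j, star (ψ₁ (Ls₁ j)) ⬝ᵥ ψ₁ (Ls₁ j) = 1) → ω₁.IsTorusLimitOf ψ₁ Ls₁ →
      ω₁.meanEnergy (hubbardTTPrimeFermionInteraction 0 1 0) 1 ≤ A)
    {s : ℝ} (h₁ : s₁ ≤ s) (h₂ : s ≤ s₂) :
    energyDensityTT' t s U n ≤
      max R₁ R₂ + (s₂ - s₁) * (max A 0 * max ((R₂ - L₃) / (s₃ - s₂)) 0) /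
        (max A 0 + max ((R₂ - L₃) / (s₃ - s₂)) 0) := by
  have hup := energyDensityTT'_sub_le_mul_of_forall_diagHop_le t (le_refl s₁) h₁ hU hn0 hn2 hA
  have hl : energyDensityTT' t s U n ≤ R₁ + A * (s - s₁) := by linarith
  have hr : energyDensityTT' t s U n ≤ R₂ + (R₂ - L₃) / (s₃ - s₂) * (s₂ - s) := by
    rcases h₂.eq_or_lt with h | h
    · rw [h, sub_self, mul_zero, add_zero]; exact hR₂
    · have h' := energyDensityTT'_tPrime_le_extrapolate_left t hU hn0 hn2 h h₂₃ hR₂ hL₃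
      have e : R₂ + (R₂ - L₃) * (s₂ - s) / (s₃ - s₂) = R₂ + (R₂ - L₃) / (s₃ - s₂) * (s₂ - s) := by
        ring
      rwa [e] at h'
  exact le_max_add_bulge_of_le_two_affine h₁ h₂ hl hr

/-- **Mixed: secant at the left column, floor word at the right.** Columns `s₀ < s₁ ≤ s ≤ s₂`, a floor
`L₀` at `s₀`, caps `R₁`, `R₂`, a floor word `B` at `s₂`: on `[s₁, s₂]`,
`e(t,s,U,n) ≤ max R₁ R₂ + (s₂ - s₁)·(α⁺ (-B)⁺)/(α⁺ + (-B)⁺)`, `α = (R₁ - L₀)/(s₁ - s₀)`.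
[cite: KomaTasaki1994, §1] [cite: Ruelle1969, §3.3] -/
theorem energyDensityTT'_tPrime_interval_le_of_leftSecant_rightWord (t : ℝ) {U : ℝ} (hU : 0 ≤ U)
    {n : ℝ} (hn0 : 0 ≤ n) (hn2 : n < 2) {s₀ s₁ s₂ L₀ R₁ R₂ B : ℝ} (h₀₁ : s₀ < s₁)
    (hL₀ : L₀ ≤ energyDensityTT' t s₀ U n) (hR₁ : energyDensityTT' t s₁ U n ≤ R₁)
    (hR₂ : energyDensityTT' t s₂ U n ≤ R₂)
    (hB : ∀ (ω₂ : InfVolFermionState 2) (Ls₂ : ℕ → ℕ) (ψ₂ : ∀ L, Fock (Orb (FermionTorus 2 L))),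
      Tendsto Ls₂ atTop atTop →
      (∀ j, IsGroundStateInSector (hubbardTorusTT' (Ls₂ j) t s₂ U) (rectN n (Ls₂ j)) 0 (ψ₂ (Ls₂ j))) →
      (∀ j, star (ψ₂ (Ls₂ j)) ⬝ᵥ ψ₂ (Ls₂ j) = 1) → ω₂.IsTorusLimitOf ψ₂ Ls₂ →
      B ≤ ω₂.meanEnergy (hubbardTTPrimeFermionInteraction 0 1 0) 1)
    {s : ℝ} (h₁ : s₁ ≤ s) (h₂ : s ≤ s₂) :
    energyDensityTT' t s U n ≤
      max R₁ R₂ + (s₂ - s₁) * (max ((R₁ - L₀) / (s₁ - s₀)) 0 * max (-B) 0) /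
        (max ((R₁ - L₀) / (s₁ - s₀)) 0 + max (-B) 0) := by
  have hdn := mul_le_energyDensityTT'_sub_of_forall_le_diagHop t h₂ (le_refl s₂) hU hn0 hn2 hB
  have hr : energyDensityTT' t s U n ≤ R₂ + (-B) * (s₂ - s) := by linarith
  have hl : energyDensityTT' t s U n ≤ R₁ + (R₁ - L₀) / (s₁ - s₀) * (s - s₁) := by
    rcases h₁.eq_or_lt with h | h
    · rw [← h, sub_self, mul_zero, add_zero]; exact hR₁
    · have h' := energyDensityTT'_tPrime_le_extrapolate_right t hU hn0 hn2 h₀₁ h hL₀ hR₁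
      have e : R₁ + (R₁ - L₀) * (s - s₁) / (s₁ - s₀) = R₁ + (R₁ - L₀) / (s₁ - s₀) * (s - s₁) := by
        ring
      rwa [e] at h'
  exact le_max_add_bulge_of_le_two_affine h₁ h₂ hl hr

/-! ### §4 Consumer shape: two anchor columns with full `(docc, K₂)` slope packages ⇒ a rectangle -/

/-- **Two tangent planes ⇒ one rectangle cap.** Two anchor columns `(s₁, U₀₁)` and `(s₂, U₀₂)`
(`U₀₁, U₀₂ ≥ 0`, `0 ≤ n < 2`), each with a certified cap `e(t,sᵢ,U₀ᵢ,n) ≤ Rᵢ` and the slope-bracket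
package of `energyDensityTT'_le_of_forall_isTorusLimitOf_slopes` (double occupancy in `[dloᵢ, dhiᵢ]`,
`K₂` in `[τloᵢ, τhiᵢ]`, `τloᵢ ≤ τhiᵢ`, for every torus-limit ground state at the anchor). Then at
every point `(t', U)` of a rectangle `[s₁, s₂] × [V₁, V₂]` with `V₁ ≥ 0`:
`e(t,t',U,n) ≤ max P₁ P₂ + (s₂ - s₁)·(τhi₁⁺ (-τlo₂)⁺)/(τhi₁⁺ + (-τlo₂)⁺)`, where
`Pᵢ = Rᵢ + max (max ((V₁-U₀ᵢ)dloᵢ) ((V₂-U₀ᵢ)dloᵢ)) (max ((V₁-U₀ᵢ)dhiᵢ) ((V₂-U₀ᵢ)dhiᵢ))` is anchor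
`i`'s cap plus the corner maximum of its sign-split `U`-slope term — the minimum of the two anchor
planes of `HubbardTTPrimeBoxWordCovering` §1, uniformised: ONE number caps the cell, with the
harmonic `t'`-bulge instead of the full gap at one anchor's bracket end. [cite: KomaTasaki1994, §1]
[cite: Israel1979, Thm. I.3.4] [cite: Neumaier2004CompleteSearch, §11] -/
theorem energyDensityTT'_rect_le_of_two_slopePackages (t : ℝ) {n : ℝ} (hn0 : 0 ≤ n) (hn2 : n < 2)
    {s₁ s₂ U₀₁ U₀₂ : ℝ} (hU₀₁ : 0 ≤ U₀₁) (hU₀₂ : 0 ≤ U₀₂)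
    {R₁ dlo₁ dhi₁ τlo₁ τhi₁ R₂ dlo₂ dhi₂ τlo₂ τhi₂ : ℝ} (hτ₁ : τlo₁ ≤ τhi₁) (hτ₂ : τlo₂ ≤ τhi₂)
    (hR₁ : energyDensityTT' t s₁ U₀₁ n ≤ R₁) (hR₂ : energyDensityTT' t s₂ U₀₂ n ≤ R₂)
    (hslopes₁ : ∀ (ω : InfVolFermionState 2) (Ls : ℕ → ℕ) (ψ : ∀ L, Fock (Orb (FermionTorus 2 L))),
      Tendsto Ls atTop atTop →
      (∀ j, IsGroundStateInSector (hubbardTorusTT' (Ls j) t s₁ U₀₁) (rectN n (Ls j)) 0 (ψ (Ls j))) →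
      (∀ j, star (ψ (Ls j)) ⬝ᵥ ψ (Ls j) = 1) → ω.IsTorusLimitOf ψ Ls →
      dlo₁ ≤ (ω.expect ({0} : Finset (Site 2))
          (nAt 0 (Finset.mem_singleton_self 0) 0 * nAt 0 (Finset.mem_singleton_self 0) 1)).re ∧
        (ω.expect ({0} : Finset (Site 2))
          (nAt 0 (Finset.mem_singleton_self 0) 0 * nAt 0 (Finset.mem_singleton_self 0) 1)).re ≤ dhi₁ ∧
        τlo₁ ≤ ω.meanEnergy (hubbardTTPrimeFermionInteraction 0 1 0) 1 ∧
        ω.meanEnergy (hubbardTTPrimeFermionInteraction 0 1 0) 1 ≤ τhi₁)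
    (hslopes₂ : ∀ (ω : InfVolFermionState 2) (Ls : ℕ → ℕ) (ψ : ∀ L, Fock (Orb (FermionTorus 2 L))),
      Tendsto Ls atTop atTop →
      (∀ j, IsGroundStateInSector (hubbardTorusTT' (Ls j) t s₂ U₀₂) (rectN n (Ls j)) 0 (ψ (Ls j))) →
      (∀ j, star (ψ (Ls j)) ⬝ᵥ ψ (Ls j) = 1) → ω.IsTorusLimitOf ψ Ls →
      dlo₂ ≤ (ω.expect ({0} : Finset (Site 2))
          (nAt 0 (Finset.mem_singleton_self 0) 0 * nAt 0 (Finset.mem_singleton_self 0) 1)).re ∧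
        (ω.expect ({0} : Finset (Site 2))
          (nAt 0 (Finset.mem_singleton_self 0) 0 * nAt 0 (Finset.mem_singleton_self 0) 1)).re ≤ dhi₂ ∧
        τlo₂ ≤ ω.meanEnergy (hubbardTTPrimeFermionInteraction 0 1 0) 1 ∧
        ω.meanEnergy (hubbardTTPrimeFermionInteraction 0 1 0) 1 ≤ τhi₂)
    {V₁ V₂ : ℝ} (hV₁ : 0 ≤ V₁) {t' U : ℝ} (hs₁ : s₁ ≤ t') (hs₂ : t' ≤ s₂) (hU₁ : V₁ ≤ U)
    (hU₂ : U ≤ V₂) :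
    energyDensityTT' t t' U n ≤
      max (R₁ + max (max ((V₁ - U₀₁) * dlo₁) ((V₂ - U₀₁) * dlo₁))
                   (max ((V₁ - U₀₁) * dhi₁) ((V₂ - U₀₁) * dhi₁)))
          (R₂ + max (max ((V₁ - U₀₂) * dlo₂) ((V₂ - U₀₂) * dlo₂))
                   (max ((V₁ - U₀₂) * dhi₂) ((V₂ - U₀₂) * dhi₂))) +
        (s₂ - s₁) * (max τhi₁ 0 * max (-τlo₂) 0) / (max τhi₁ 0 + max (-τlo₂) 0) := by
  have hU : 0 ≤ U := hV₁.trans hU₁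
  -- the two anchor planes at `(t', U)`
  have h1 := energyDensityTT'_le_of_forall_isTorusLimitOf_slopes t s₁ hU₀₁ hn0 hn2 hR₁ hslopes₁ t' hU
  have h2 := energyDensityTT'_le_of_forall_isTorusLimitOf_slopes t s₂ hU₀₂ hn0 hn2 hR₂ hslopes₂ t' hU
  -- uniformise the `U`-terms over `[V₁, V₂]`
  have hD1 := max_sub_mul_le_cornerMax (U₀ := U₀₁) (dlo := dlo₁) (dhi := dhi₁) hU₁ hU₂
  have hD2 := max_sub_mul_le_cornerMax (U₀ := U₀₂) (dlo := dlo₂) (dhi := dhi₂) hU₁ hU₂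
  -- the `t'`-terms read towards the interior of the cell
  have hT1 : max ((t' - s₁) * τlo₁) ((t' - s₁) * τhi₁) ≤ τhi₁ * (t' - s₁) := by
    rw [mul_comm τhi₁]
    exact max_le (mul_le_mul_of_nonneg_left hτ₁ (sub_nonneg.2 hs₁)) le_rfl
  have hT2 : max ((t' - s₂) * τlo₂) ((t' - s₂) * τhi₂) ≤ (-τlo₂) * (s₂ - t') := by
    have e : (-τlo₂) * (s₂ - t') = (t' - s₂) * τlo₂ := by ring
    rw [e]
    exact max_le le_rfl (mul_le_mul_of_nonpos_left hτ₂ (sub_nonpos.2 hs₂))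
  exact le_max_add_bulge_of_le_two_affine hs₁ hs₂ (by linarith) (by linarith)

/-- **Same anchor height, columns on the cell's upper edge** (the census case: both columns at
`U⁰ = V₂`, so the `U`-slope terms are not needed — `e` is non-decreasing in `U`): caps `R₁`, `R₂` at
`(s₁, V₂)`, `(s₂, V₂)`, a ceiling word `A` at `(s₁, V₂)` and a floor word `B` at `(s₂, V₂)` cap the
whole rectangle `[s₁, s₂] × [V₁, V₂]` (`0 ≤ V₁`) by `max R₁ R₂ + (s₂ - s₁)·(A⁺ (-B)⁺)/(A⁺ + (-B)⁺)`.
[cite: KomaTasaki1994, §1] [cite: Israel1979, Thm. I.3.4] -/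
theorem energyDensityTT'_rect_le_of_upperColumnWords (t : ℝ) {n : ℝ} (hn0 : 0 ≤ n) (hn2 : n < 2)
    {s₁ s₂ V₁ V₂ R₁ R₂ A B : ℝ} (hV₁ : 0 ≤ V₁) (hV₁₂ : V₁ ≤ V₂)
    (hR₁ : energyDensityTT' t s₁ V₂ n ≤ R₁) (hR₂ : energyDensityTT' t s₂ V₂ n ≤ R₂)
    (hA : ∀ (ω₁ : InfVolFermionState 2) (Ls₁ : ℕ → ℕ) (ψ₁ : ∀ L, Fock (Orb (FermionTorus 2 L))),
      Tendsto Ls₁ atTop atTop →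
      (∀ j, IsGroundStateInSector (hubbardTorusTT' (Ls₁ j) t s₁ V₂) (rectN n (Ls₁ j)) 0 (ψ₁ (Ls₁ j))) →
      (∀ j, star (ψ₁ (Ls₁ j)) ⬝ᵥ ψ₁ (Ls₁ j) = 1) → ω₁.IsTorusLimitOf ψ₁ Ls₁ →
      ω₁.meanEnergy (hubbardTTPrimeFermionInteraction 0 1 0) 1 ≤ A)
    (hB : ∀ (ω₂ : InfVolFermionState 2) (Ls₂ : ℕ → ℕ) (ψ₂ : ∀ L, Fock (Orb (FermionTorus 2 L))),
      Tendsto Ls₂ atTop atTop →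
      (∀ j, IsGroundStateInSector (hubbardTorusTT' (Ls₂ j) t s₂ V₂) (rectN n (Ls₂ j)) 0 (ψ₂ (Ls₂ j))) →
      (∀ j, star (ψ₂ (Ls₂ j)) ⬝ᵥ ψ₂ (Ls₂ j) = 1) → ω₂.IsTorusLimitOf ψ₂ Ls₂ →
      B ≤ ω₂.meanEnergy (hubbardTTPrimeFermionInteraction 0 1 0) 1)
    {t' U : ℝ} (hs₁ : s₁ ≤ t') (hs₂ : t' ≤ s₂) (hU₁ : V₁ ≤ U) (hU₂ : U ≤ V₂) :
    energyDensityTT' t t' U n ≤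
      max R₁ R₂ + (s₂ - s₁) * (max A 0 * max (-B) 0) / (max A 0 + max (-B) 0) := by
  have hmono := energyDensityTT'_mono_U t t' hn0 hn2 (hV₁.trans hU₁) hU₂
  exact hmono.trans (energyDensityTT'_tPrime_interval_le_of_columnWords t (hV₁.trans hV₁₂) hn0 hn2
    hR₁ hR₂ hA hB hs₁ hs₂)

/-! ### §5 The 3-D cell: `(t', U)`-rectangle × filling interval, caps and words at the four upper corners
(the word twin of `energyDensityTT'_box₃_le_of_upper_corner_caps_kinematic`, `HubbardTTPrimeBoxTransport` §6) -/

/-- **3-D cell CAP from the four upper-`U` corners' caps and `K₂` words.** Rectangle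
`[s₁, s₂] × [U₁, U₂]` (`0 ≤ U₁ ≤ U₂`) times a filling interval `[n₁, n₂]` (`0 ≤ n₁`, `n₂ < 2`); at the
filling endpoint `n₁`: caps `R₁`, `R₂` at `(s₁,U₂)`, `(s₂,U₂)`, a ceiling word `A` at `(s₁,U₂)` and a
floor word `B` at `(s₂,U₂)`; at `n₂`: the primed data. Then on the whole 3-D cell
`e ≤ max (max R₁ R₂ + w·A⁺(-B)⁺/(A⁺+(-B)⁺)) (max R₁' R₂' + w·A'⁺(-B')⁺/(A'⁺+(-B')⁺))`, `w = s₂ − s₁`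
(convexity in the density: `energyDensityTT'_box₃_le_max`; each face by
`energyDensityTT'_rect_le_of_upperColumnWords`). [cite: Israel1979, Thm. I.3.4]
[cite: Neumaier2004CompleteSearch, §11] -/
theorem energyDensityTT'_box₃_le_of_upperColumnWords (t : ℝ) {s₁ s₂ U₁ U₂ n₁ n₂ : ℝ}
    (hU₁ : 0 ≤ U₁) (hU12 : U₁ ≤ U₂) (hn₁ : 0 ≤ n₁) (hn₂ : n₂ < 2) {R₁ R₂ A B R₁' R₂' A' B' : ℝ}
    (hR₁ : energyDensityTT' t s₁ U₂ n₁ ≤ R₁) (hR₂ : energyDensityTT' t s₂ U₂ n₁ ≤ R₂)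
    (hA : ∀ (ω : InfVolFermionState 2) (Ls : ℕ → ℕ) (ψ : ∀ L, Fock (Orb (FermionTorus 2 L))),
      Tendsto Ls atTop atTop →
      (∀ j, IsGroundStateInSector (hubbardTorusTT' (Ls j) t s₁ U₂) (rectN n₁ (Ls j)) 0 (ψ (Ls j))) →
      (∀ j, star (ψ (Ls j)) ⬝ᵥ ψ (Ls j) = 1) → ω.IsTorusLimitOf ψ Ls →
      ω.meanEnergy (hubbardTTPrimeFermionInteraction 0 1 0) 1 ≤ A)
    (hB : ∀ (ω : InfVolFermionState 2) (Ls : ℕ → ℕ) (ψ : ∀ L, Fock (Orb (FermionTorus 2 L))),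
      Tendsto Ls atTop atTop →
      (∀ j, IsGroundStateInSector (hubbardTorusTT' (Ls j) t s₂ U₂) (rectN n₁ (Ls j)) 0 (ψ (Ls j))) →
      (∀ j, star (ψ (Ls j)) ⬝ᵥ ψ (Ls j) = 1) → ω.IsTorusLimitOf ψ Ls →
      B ≤ ω.meanEnergy (hubbardTTPrimeFermionInteraction 0 1 0) 1)
    (hR₁' : energyDensityTT' t s₁ U₂ n₂ ≤ R₁') (hR₂' : energyDensityTT' t s₂ U₂ n₂ ≤ R₂')
    (hA' : ∀ (ω : InfVolFermionState 2) (Ls : ℕ → ℕ) (ψ : ∀ L, Fock (Orb (FermionTorus 2 L))),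
      Tendsto Ls atTop atTop →
      (∀ j, IsGroundStateInSector (hubbardTorusTT' (Ls j) t s₁ U₂) (rectN n₂ (Ls j)) 0 (ψ (Ls j))) →
      (∀ j, star (ψ (Ls j)) ⬝ᵥ ψ (Ls j) = 1) → ω.IsTorusLimitOf ψ Ls →
      ω.meanEnergy (hubbardTTPrimeFermionInteraction 0 1 0) 1 ≤ A')
    (hB' : ∀ (ω : InfVolFermionState 2) (Ls : ℕ → ℕ) (ψ : ∀ L, Fock (Orb (FermionTorus 2 L))),
      Tendsto Ls atTop atTop →
      (∀ j, IsGroundStateInSector (hubbardTorusTT' (Ls j) t s₂ U₂) (rectN n₂ (Ls j)) 0 (ψ (Ls j))) →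
      (∀ j, star (ψ (Ls j)) ⬝ᵥ ψ (Ls j) = 1) → ω.IsTorusLimitOf ψ Ls →
      B' ≤ ω.meanEnergy (hubbardTTPrimeFermionInteraction 0 1 0) 1)
    {s U n : ℝ} (hs₁ : s₁ ≤ s) (hs₂ : s ≤ s₂) (hU₁' : U₁ ≤ U) (hU₂ : U ≤ U₂)
    (hn : n ∈ Set.Icc n₁ n₂) :
    energyDensityTT' t s U n ≤
      max (max R₁ R₂ + (s₂ - s₁) * (max A 0 * max (-B) 0) / (max A 0 + max (-B) 0))
        (max R₁' R₂' + (s₂ - s₁) * (max A' 0 * max (-B') 0) / (max A' 0 + max (-B') 0)) := by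
  have hn₁2 : n₁ < 2 := lt_of_le_of_lt (hn.1.trans hn.2) hn₂
  have hn₂0 : 0 ≤ n₂ := hn₁.trans (hn.1.trans hn.2)
  exact energyDensityTT'_box₃_le_max t hU₁ hn₁ hn₂
    (fun s' U' h1 h2 h3 h4 =>
      energyDensityTT'_rect_le_of_upperColumnWords t hn₁ hn₁2 hU₁ hU12 hR₁ hR₂ hA hB h1 h2 h3 h4)
    (fun s' U' h1 h2 h3 h4 =>
      energyDensityTT'_rect_le_of_upperColumnWords t hn₂0 hn₂ hU₁ hU12 hR₁' hR₂' hA' hB' h1 h2 h3 h4)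
    hs₁ hs₂ hU₁' hU₂ hn

end ThermodynamicLimit

end Literature.MathematicalPhysics.QuantumLattice

end
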